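import Mathlib.NumberTheory.Padics.Complex
import Mathlib.NumberTheory.Padics.ProperSpace
import Mathlib.NumberTheory.Padics.MahlerBasis
import Mathlib.RingTheory.PowerSeries.Binomial
import Mathlib.Analysis.Normed.Group.Ultra
import Mathlib.Topology.MetricSpace.HausdorffDistance
import Literature.NumberTheory.LFunctions.DworkRationalityBorelDwork
import HarnessLib

/-!
# Bounded binomial series have `ℤ_p`-exponent: `sup_n ‖C(a,n)‖ < ∞` in `ℂ_p` forces `a ∈ ℤ_p`
# (helper file for crux 2 `GoodLatticeBDPValue`, stmt-BirchSwinnertonDyer-19032, line `halves`, stub 3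
# `stub_anDS`, piece AN-F₂ `KatzLineDescentAt` of `Cruxes/GoodLatticeBDPValue/Lines/halves_anDS_split_idea11g4.lean`;
# seat `bsd-line-x1-p1-w3` gen 2)

Route (RIG) of AN-F₂ («different-period rigidity») compares two CGLS-type frames `Q`, `L` of one
`θ_K`: along the powers of one interpolation character they satisfy `Q(u^k − 1) = d^k · L(u^k − 1)`,
and the Wronskian step (`…KatzLineDescentWronskian`) turns this into `L = c·(1+T)^{−a}·Q` in
`ℂ_p⟦T⟧`. The ONLY place where the integrality of `L` enters is then the classical fact proved here:
the binomial series `(1+T)^a = Σ_n C(a,n) T^n ∈ ℂ_p⟦T⟧` has BOUNDED coefficients iff `a ∈ ℤ_p`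
(Washington, proof of Prop. 7.2 / §5.1: `C(a,n) ∈ ℤ_p` for `a ∈ ℤ_p`; conversely — the content of
this file — if `a ∉ ℤ_p` then, after an integer shift `b = a − j₀` making `‖b − j‖ ≥ ‖b‖ = dist(a, ℤ_p)`
for all `j ∈ ℕ` (compactness of `ℤ_p ⊂ ℂ_p` and density of `ℕ`), one has
`‖C(b,n)‖ = ‖n!‖⁻¹ ∏_{j<n} ‖b − j‖ ≥ dist(a, ℤ_p)/‖n‖`, unbounded along `n = p^N`, while
`‖C(b,n)‖ ≤ sup_i ‖C(a,i)‖` by Vandermonde). In the descent this is the step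
«boundedness forces the period ratio `c^{2n₁}` into `u^{ℤ_p}`» of the idea file's docstring.

* §1 `norm_descPochhammer_smeval`: `‖a(a−1)⋯(a−n+1)‖ = ∏_{j<n} ‖a − j‖`;
  `norm_choose_eq`: `‖C(a,n)‖ = ‖n!‖⁻¹ · ∏_{j<n} ‖a − j‖`.
* §2 `norm_choose_intCast_le_one`, `norm_choose_sub_natCast_le`: Vandermonde transport of a bound
  under an integer shift.
* §3 `norm_choose_ge_of_forall_le_norm_sub`: if `‖j‖ ≤ ‖b − j‖` for all `j ∈ ℕ` then
  `‖b‖/‖n‖ ≤ ‖C(b,n)‖` (`n ≥ 1`).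
* §4 `exists_padicInt_eq_of_norm_choose_le`: `(∀ n, ‖C(a,n)‖ ≤ M) → ∃ b : ℤ_p, b = a`; with the converse
  `norm_choose_le_one_of_padicInt` and the `iff`.

Pure `p`-adic analysis; no fact, no definition, no `sorry`; nothing about BSD.
References: Washington 1997 §5.1 (binomial coefficients on `ℤ_p`), §7.1 Prop. 7.2, §7.2; Cassels 1986 Ch. 4.
-/

-- the summit namespace `Summit.BirchSwinnertonDyer.BirchSwinnertonDyer` repeats the problem name by design (D-0017)
set_option linter.dupNamespace false
set_option autoImplicit false

noncomputable section

open scoped Classical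

open Finset Metric

namespace Summit.BirchSwinnertonDyer.BirchSwinnertonDyer.Theorems.KatzLineDescent

variable {p : ℕ} [Fact p.Prime]

/-! ## §1 The norm of a generalized binomial coefficient -/

/-- `desc_{n+1}(a) = desc_n(a)·(a − n)` for the falling factorial `(descPochhammer ℤ n).smeval a`.
[cite: Washington1997, §5.1] -/
theorem descPochhammer_smeval_succ {R : Type*} [CommRing R] (a : R) (n : ℕ) :
    (descPochhammer ℤ (n + 1)).smeval a = (descPochhammer ℤ n).smeval a * (a - n) := by
  rw [descPochhammer_succ_right, Polynomial.smeval_mul, Polynomial.smeval_sub,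
    Polynomial.smeval_X, Polynomial.smeval_natCast]
  simp only [pow_one, pow_zero, nsmul_eq_mul, mul_one]

/-- `‖a(a−1)⋯(a−n+1)‖ = ∏_{j<n} ‖a − j‖` in `ℂ_p`. [cite: Washington1997, §5.1] -/
theorem norm_descPochhammer_smeval (a : ℂ_[p]) (n : ℕ) :
    ‖(descPochhammer ℤ n).smeval a‖ = ∏ j ∈ range n, ‖a - j‖ := by
  induction n with
  | zero => simp [descPochhammer_zero, Polynomial.smeval_one]
  | succ n ih => rw [descPochhammer_smeval_succ, norm_mul, ih, prod_range_succ]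

/-- **`‖C(a,n)‖ = ‖n!‖⁻¹ · ∏_{j<n} ‖a − j‖`** in `ℂ_p`. [cite: Washington1997, §5.1] -/
theorem norm_choose_eq (a : ℂ_[p]) (n : ℕ) :
    ‖Ring.choose a n‖ = ‖((n.factorial : ℕ) : ℂ_[p])‖⁻¹ * ∏ j ∈ range n, ‖a - j‖ := by
  rw [Ring.choose_eq_smul, norm_smul, norm_inv, norm_descPochhammer_smeval]

/-! ## §2 Integer shifts (Vandermonde) -/

/-- `C(m, n) ∈ ℤ` for an integer `m`, so `‖C(m,n)‖ ≤ 1` in `ℂ_p`. [cite: Washington1997, §5.1] -/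
theorem norm_choose_intCast_le_one (m : ℤ) (n : ℕ) : ‖Ring.choose (m : ℂ_[p]) n‖ ≤ 1 := by
  have h := Ring.map_choose (Int.castRingHom ℂ_[p]) m n
  simp only [eq_intCast] at h
  rw [← h]
  exact Literature.NumberTheory.LFunctions.Dwork.norm_intCast_le_one (p := p) _

/-- **Vandermonde transport of a bound**: `‖C(a − j₀, n)‖ ≤ M` whenever `‖C(a, i)‖ ≤ M` for all `i`
(`C(a − j₀, n) = Σ_{i+l=n} C(a,i)·C(−j₀,l)`, ultrametric inequality). [cite: Washington1997, §5.1] -/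
theorem norm_choose_sub_natCast_le {a : ℂ_[p]} {M : ℝ} (hM : ∀ i : ℕ, ‖Ring.choose a i‖ ≤ M)
    (j₀ n : ℕ) : ‖Ring.choose (a - j₀) n‖ ≤ M := by
  have hM0 : 0 ≤ M := le_trans (norm_nonneg _) (hM 0)
  rw [sub_eq_add_neg, Ring.add_choose_eq n (Commute.all _ _)]
  refine IsUltrametricDist.norm_sum_le_of_forall_le_of_nonneg hM0 fun ij _ ↦ ?_
  rw [norm_mul]
  have h2 : ‖Ring.choose (-(j₀ : ℂ_[p])) ij.2‖ ≤ 1 := by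
    have : (-(j₀ : ℂ_[p])) = ((-(j₀ : ℤ) : ℤ) : ℂ_[p]) := by push_cast; ring
    rw [this]
    exact norm_choose_intCast_le_one _ _
  calc ‖Ring.choose a ij.1‖ * ‖Ring.choose (-(j₀ : ℂ_[p])) ij.2‖
      ≤ M * 1 := mul_le_mul (hM _) h2 (norm_nonneg _) hM0
    _ = M := mul_one M

/-! ## §3 The lower bound after a best-approximation shift -/

/-- **If `‖j‖ ≤ ‖b − j‖` for every `j ∈ ℕ`, then `‖b‖/‖n‖ ≤ ‖C(b,n)‖`** (`n ≥ 1`):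
`‖C(b,n)‖ = ‖n!‖⁻¹·‖b‖·∏_{1≤j<n}‖b − j‖ ≥ ‖n!‖⁻¹·‖b‖·‖(n−1)!‖ = ‖b‖/‖n‖`. [cite: Washington1997, §5.1, §7.2] -/
theorem norm_choose_ge_of_forall_le_norm_sub {b : ℂ_[p]}
    (hb : ∀ j : ℕ, ‖(j : ℂ_[p])‖ ≤ ‖b - j‖) {n : ℕ} (hn : 1 ≤ n) :
    ‖b‖ / ‖(n : ℂ_[p])‖ ≤ ‖Ring.choose b n‖ := by
  obtain ⟨m, rfl⟩ := Nat.exists_eq_add_of_le' hn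
  rw [norm_choose_eq]
  -- `∏_{j < m+1} ‖b - j‖ = ‖b‖ * ∏_{j < m} ‖b - (j+1)‖ ≥ ‖b‖ * ∏_{j<m} ‖j+1‖ = ‖b‖ * ‖m!‖`
  have hprod : ‖b‖ * ‖((m.factorial : ℕ) : ℂ_[p])‖ ≤ ∏ j ∈ range (m + 1), ‖b - j‖ := by
    rw [prod_range_succ', Nat.cast_zero, sub_zero, mul_comm]
    refine mul_le_mul_of_nonneg_right ?_ (norm_nonneg _)
    have hfac : ‖((m.factorial : ℕ) : ℂ_[p])‖ = ∏ j ∈ range m, ‖((j + 1 : ℕ) : ℂ_[p])‖ := by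
      rw [← prod_range_add_one_eq_factorial, Nat.cast_prod, norm_prod]
    rw [hfac]
    exact prod_le_prod (fun j _ ↦ norm_nonneg _) fun j _ ↦ by exact_mod_cast hb (j + 1)
  have hfac_pos : 0 < ‖(((m + 1).factorial : ℕ) : ℂ_[p])‖ :=
    norm_pos_iff.mpr (by exact_mod_cast Nat.factorial_ne_zero _)
  have hn_pos : 0 < ‖((m + 1 : ℕ) : ℂ_[p])‖ := norm_pos_iff.mpr (by exact_mod_cast Nat.succ_ne_zero m)
  rw [div_le_iff₀ hn_pos]
  -- `‖(m+1)!‖ = ‖m+1‖ * ‖m!‖`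
  have hsplit : ‖(((m + 1).factorial : ℕ) : ℂ_[p])‖ =
      ‖((m + 1 : ℕ) : ℂ_[p])‖ * ‖((m.factorial : ℕ) : ℂ_[p])‖ := by
    rw [Nat.factorial_succ, Nat.cast_mul, norm_mul]
  have hfm_pos : 0 < ‖((m.factorial : ℕ) : ℂ_[p])‖ :=
    norm_pos_iff.mpr (by exact_mod_cast Nat.factorial_ne_zero _)
  calc ‖b‖ = (‖(((m + 1).factorial : ℕ) : ℂ_[p])‖⁻¹ * (‖b‖ * ‖((m.factorial : ℕ) : ℂ_[p])‖)) *
        ‖((m + 1 : ℕ) : ℂ_[p])‖ := by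
          rw [hsplit]; field_simp
    _ ≤ (‖(((m + 1).factorial : ℕ) : ℂ_[p])‖⁻¹ * ∏ j ∈ range (m + 1), ‖b - j‖) *
        ‖((m + 1 : ℕ) : ℂ_[p])‖ := by
          gcongr

/-! ## §4 Bounded binomial series have exponent in `ℤ_p` -/

/-- The structure map `ℤ_p → ℂ_p` preserves norms. [cite: Washington1997, §5.1] -/
theorem norm_coe_padicInt (b : ℤ_[p]) : ‖((b : ℚ_[p]) : ℂ_[p])‖ = ‖b‖ := by
  rw [PadicComplex.norm_extends', PadicInt.norm_def]

/-- The structure map `ℤ_p → ℂ_p` is a ring homomorphism (it is `algebraMap ℚ_p ℂ_p ∘ (ℤ_p ⊂ ℚ_p)`).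
[cite: Washington1997, §5.1] -/
theorem coe_padicInt_eq_ringHom (b : ℤ_[p]) :
    ((b : ℚ_[p]) : ℂ_[p]) = ((algebraMap ℚ_[p] ℂ_[p]).comp PadicInt.Coe.ringHom) b := by
  rfl

/-- **`C(b,n) ∈ ℤ_p` for `b ∈ ℤ_p`** (Washington Prop. 5.1 style): the binomial coefficients of an
element of `ℤ_p ⊂ ℂ_p` have norm `≤ 1`. [cite: Washington1997, §5.1] -/
theorem norm_choose_le_one_of_padicInt (b : ℤ_[p]) (n : ℕ) :
    ‖Ring.choose ((b : ℚ_[p]) : ℂ_[p]) n‖ ≤ 1 := by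
  rw [coe_padicInt_eq_ringHom, ← Ring.map_choose, ← coe_padicInt_eq_ringHom, norm_coe_padicInt]
  exact PadicInt.norm_le_one _

/-- **Bounded binomial coefficients force `a ∈ ℤ_p`.** If `‖C(a,n)‖ ≤ M` for all `n` (`a ∈ ℂ_p`), then
`a` lies in (the image of) `ℤ_p`. Proof: otherwise `δ := dist(a, ℤ_p) > 0` is attained (`ℤ_p` is
compact) and, `ℕ` being dense in `ℤ_p`, some `b = a − j₀` (`j₀ ∈ ℕ`) has `‖b‖ ≤ δ ≤ ‖b − j‖` for every
`j ∈ ℕ`, whence `‖j‖ ≤ ‖b − j‖`; §3 gives `‖C(b, p^N)‖ ≥ δ·p^N`, while §2 gives `‖C(b, n)‖ ≤ M`.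
[cite: Washington1997, §5.1, §7.2] [cite: Cassels1986, Ch. 4] -/
theorem exists_padicInt_eq_of_norm_choose_le {a : ℂ_[p]} {M : ℝ}
    (hM : ∀ n : ℕ, ‖Ring.choose a n‖ ≤ M) : ∃ b : ℤ_[p], ((b : ℚ_[p]) : ℂ_[p]) = a := by
  by_contra H
  push Not at H
  -- the structure map and its range
  set φ : ℤ_[p] → ℂ_[p] := fun b ↦ ((b : ℚ_[p]) : ℂ_[p]) with hφ
  have hφsub : ∀ x y : ℤ_[p], φ x - φ y = φ (x - y) := by
    intro x y; simp only [hφ, coe_padicInt_eq_ringHom, map_sub]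
  have hφcont : Continuous φ := by
    refine continuous_iff_continuousAt.mpr fun x ↦ ?_
    refine Metric.continuousAt_iff.mpr fun ε hε ↦ ⟨ε, hε, fun y hy ↦ ?_⟩
    rwa [dist_eq_norm, hφsub, hφ, norm_coe_padicInt, ← dist_eq_norm]
  set S : Set ℂ_[p] := Set.range φ with hS
  have hScpt : IsCompact S := isCompact_range hφcont
  have hSne : S.Nonempty := Set.range_nonempty φ
  have haS : a ∉ S := by
    rintro ⟨b, hb⟩; exact H b hb
  -- the distance to `ℤ_p` is positive and attained
  set δ := infDist a S with hδ
  have hδpos : 0 < δ := (hScpt.isClosed.notMem_iff_infDist_pos hSne).mp haS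
  obtain ⟨c₀, ⟨b₀, rfl⟩, hc₀⟩ := hScpt.exists_infDist_eq_dist hSne a
  -- an integer `j₀` close to `b₀`
  obtain ⟨j₀, hj₀⟩ := PadicInt.denseRange_natCast.exists_dist_lt b₀ hδpos
  set b : ℂ_[p] := a - j₀ with hb
  -- `‖b − j‖ ≥ δ` for every `j ∈ ℕ`
  have hφnat : ∀ n : ℕ, φ (n : ℤ_[p]) = (n : ℂ_[p]) := by
    intro n; simp only [hφ]; rw [coe_padicInt_eq_ringHom, map_natCast]
  have hfar : ∀ j : ℕ, δ ≤ ‖b - j‖ := by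
    intro j
    have hmem : φ ((j₀ + j : ℕ) : ℤ_[p]) ∈ S := ⟨_, rfl⟩
    have hle := infDist_le_dist_of_mem (x := a) hmem
    rw [dist_eq_norm, hφnat, Nat.cast_add] at hle
    have hrw : a - ((j₀ : ℂ_[p]) + j) = b - j := by rw [hb]; ring
    rwa [hrw] at hle
  -- `‖b‖ ≤ δ`
  have hble : ‖b‖ ≤ δ := by
    have h1 : ‖a - φ b₀‖ = δ := by rw [← dist_eq_norm, ← hc₀]
    have h2 : ‖φ b₀ - (j₀ : ℂ_[p])‖ < δ := by
      rw [← hφnat, hφsub, hφ, norm_coe_padicInt, ← dist_eq_norm]; exact hj₀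
    have hsum : b = (a - φ b₀) + (φ b₀ - (j₀ : ℂ_[p])) := by rw [hb]; ring
    rw [hsum]
    exact (IsUltrametricDist.norm_add_le_max _ _).trans (max_le h1.le h2.le)
  -- hence `‖j‖ ≤ ‖b − j‖` for all `j`
  have hkey : ∀ j : ℕ, ‖(j : ℂ_[p])‖ ≤ ‖b - j‖ := by
    intro j
    have hj : (j : ℂ_[p]) = b + -(b - j) := by ring
    calc ‖(j : ℂ_[p])‖ = ‖b + -(b - j)‖ := by rw [← hj]
      _ ≤ max ‖b‖ ‖-(b - j)‖ := IsUltrametricDist.norm_add_le_max _ _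
      _ ≤ ‖b - j‖ := by rw [norm_neg]; exact max_le (hble.trans (hfar j)) le_rfl
  -- bound transported to `b`, lower bound along `p^N`
  have hδb : δ ≤ ‖b‖ := by simpa using hfar 0
  have hup : ∀ n, ‖Ring.choose b n‖ ≤ M := norm_choose_sub_natCast_le hM j₀
  -- choose `N` with `M < δ * p^N`
  obtain ⟨N, hN⟩ := pow_unbounded_of_one_lt (M / δ) (by exact_mod_cast (Fact.out : p.Prime).one_lt : (1 : ℝ) < p)
  have hpN : ‖((p ^ N : ℕ) : ℂ_[p])‖ = ((p : ℝ) ^ N)⁻¹ := by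
    rw [← map_natCast (algebraMap ℚ_[p] ℂ_[p]), norm_algebraMap', Nat.cast_pow, norm_pow,
      Padic.norm_p, inv_pow]
  have hlow := norm_choose_ge_of_forall_le_norm_sub hkey (n := p ^ N) (Nat.one_le_pow _ _ (Fact.out : p.Prime).pos)
  rw [hpN, div_inv_eq_mul] at hlow
  have : δ * (p : ℝ) ^ N ≤ M := by
    calc δ * (p : ℝ) ^ N ≤ ‖b‖ * (p : ℝ) ^ N := by gcongr
      _ ≤ ‖Ring.choose b (p ^ N)‖ := hlow
      _ ≤ M := hup _
  rw [div_lt_iff₀ hδpos] at hN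
  linarith

/-- **The binomial series `(1+T)^a ∈ ℂ_p⟦T⟧` has bounded coefficients iff `a ∈ ℤ_p`.**
[cite: Washington1997, §5.1, §7.1 Prop. 7.2] -/
theorem bddAbove_norm_choose_iff (a : ℂ_[p]) :
    (∃ M : ℝ, ∀ n : ℕ, ‖Ring.choose a n‖ ≤ M) ↔ ∃ b : ℤ_[p], ((b : ℚ_[p]) : ℂ_[p]) = a := by
  constructor
  · rintro ⟨M, hM⟩; exact exists_padicInt_eq_of_norm_choose_le hM
  · rintro ⟨b, rfl⟩; exact ⟨1, norm_choose_le_one_of_padicInt b⟩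

/-- The same statement for Mathlib's `PowerSeries.binomialSeries ℂ_[p] a = Σ_n C(a,n) T^n`: its
coefficients are bounded iff `a ∈ ℤ_p`. [cite: Washington1997, §7.1 Prop. 7.2] -/
theorem bddAbove_norm_coeff_binomialSeries_iff (a : ℂ_[p]) :
    (∃ M : ℝ, ∀ n : ℕ, ‖PowerSeries.coeff n (PowerSeries.binomialSeries ℂ_[p] a)‖ ≤ M) ↔
      ∃ b : ℤ_[p], ((b : ℚ_[p]) : ℂ_[p]) = a := by
  simp only [PowerSeries.binomialSeries_coeff, smul_eq_mul, mul_one]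
  exact bddAbove_norm_choose_iff a

end Summit.BirchSwinnertonDyer.BirchSwinnertonDyer.Theorems.KatzLineDescent

end
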